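import Literature.NumberTheory.Automorphic.Liu2021.Thm418AsPrinted
import Mathlib.RepresentationTheory.Irreducible
import Mathlib.RepresentationTheory.Invariants
import HarnessLib

/-!
# Liu 2021, Definition 4.11 — EXACTLY AS PRINTED (statement-exact sibling record of `Thm418AsPrinted`; no proof)

[Liu2021] = Yifeng Liu, *Fourier–Jacobi cycles and arithmetic relative trace formula*, Cambridge J. Math. **9**
(2021), no. 1, 1–147 = arXiv:2102.11518.  PRIMARY SOURCE READ FOR THIS FILE: the author's TeX source of the arXiv v2
e-print, `FJcycle.tex` (md5 `6db49a74122d2cb0f224fa1b39488a0c`, 7163 lines; held at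
`run/shared/lean/pub/pub-hodgecm/pub-hodgecm-cf-kudla-howe-rallis-g4/lit/Liu21-arxiv-src/FJcycle.tex`); every `l. NNNN`
is a line of that file, `pNNNN Lk` a chunk/line of the held extraction `paper:arxiv-2102.11518` (chunk numbers are NOT
journal pages; Cambridge J. Math. page numbers are not held — `acq-07613` open — and are not quoted).  Numbering = compiled
arXiv v1 = v2 = the journal's theorem numbering (cell record `HOME/lit/LIU2021.md` §0, finding F-11).

## What this file is, and why

A SIBLING of `Literature.NumberTheory.Automorphic.Liu2021.Thm418AsPrinted` (tree, p277833): the printed sentence of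
**Definition 4.11** typed over THE SAME datum `Thm418Data F E` — no new carrier, no face-scope guard, nothing asserted.
It exists because the stage-2 junction `Model.faceSupply_of_thm418AsPrinted_pinned` (cell file
`Transposition/Item6SupplyPinned.lean`, binders `hirr` / `hsm`) consumes, BESIDE `(hLiu : Thm418AsPrinted D)`, the two
properties «irreducible» and «admissible» of the summands `ω(μ, ε, χ)`; those words are PRINTED — in Def. 4.11, which
Thm. 4.18 presupposes — and the citation desk asked that they be cited AS PRINTED rather than hand-summarised
(cell INBOX l. 3915, hodge-director INBOX l. 564: «may be typed statement-exact as sibling AS-PRINTED records … (a) the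
datum binder must be the SAME `D` as `Thm418AsPrinted` … (b) “admissible” is a printed word — type it or declare the
rendering»).  Here «admissible» IS typed (`IsSmoothRep ∧ IsAdmissibleRep` below) and «irreducible» is typed with the
paper's own convention made explicit (READING I1).  As for `Thm418AsPrinted`: `Def411AsPrinted D` is a PREDICATE on the
consumer's datum `D`; `∀ D, Def411AsPrinted D` is not claimed and is false on degenerate carriers.

## The printed text (verbatim, TeX macros resolved as in `Thm418AsPrinted`)

**Def. 4.11** (TeX label `de:oscillator_triple`, l. 2083–2097 = p0020 L29–42).  l. 2084–2091: «An *adèlic oscillator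
triple* is a triple `(μ, ε, χ)` consisting of • a conjugate symplectic automorphic character (Definition 4.1)
`μ = ⊗ μ_v : E^× \ 𝔸_E^× → ℂ^×` (whose value is necessarily in `ℂ^1`), • a collection
`ε = (ε_v ∈ E_v^{−×} / Nm_{E_v/F_v} E_v^×)_v` for every nonarchimedean place `v` of `F` such that
`ε_v ∈ O_{E_v}^× Nm_{E_v/F_v} E_v^×` for all but finitely many `v`, and • an automorphic character
`χ = ⊗ χ_v : E^1 \ (𝔸_E^∞)^1 → ℂ^×` (whose value is necessarily in `ℂ^1`).»  l. 2092–2096: «For an adèlic oscillator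
triple `(μ, ε, χ)`, the local oscillator representation `ω(μ_v, ε_v, χ_v)` of `𝔾(F_v)` introduced in Subsection D.1 is
unramified for all but finitely many `v`. Thus, it makes sense to define the *adèlic oscillator representation* attached
to `(μ, ε, χ)`
    `ω(μ, ε, χ) := ⊗'_v ω(μ_v, ε_v, χ_v)`,
which is an irreducible admissible representation of `𝔾(𝔸_F^∞)`.»

Context used for the READINGS (quoted, not typed): **App. D, §D.1, Lemma D.1** (TeX label `le:weil_nonarch`,
l. 5226–5238), about the LOCAL factor at a nonarchimedean place: «Suppose that `F` is nonarchimedean. Then `ω(μ, ε, χ)`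
is irreducible and admissible. Moreover, (1) `ω(μ, ε, χ)` is zero if and only if `E` is a field, `V` is anisotropic (in
particular `n = 2`), and `χ̌ = μ²`. […] (3) If `n ≥ 3`, then `ω(μ', ε', χ')` is isomorphic to `ω(μ, ε, χ)` if and only
if `(μ', ε', χ') = (μ, ε, χ)`.»

## The typing

* The datum is `D : Thm418Data F E` of `Thm418AsPrinted` (same file's conventions): the triple's `μ` is the structure's
  `D.μ` (REAL; conjugate symplectic — Def. 4.11 first bullet — and, as everywhere from Def. 4.5 on, of weight one), `ε`
  ranges over the ⟨CARRIER⟩ `D.Eps`, `χ` over the ⟨CARRIER⟩ `D.Chi`, and `ω(μ, ε, χ)` with its `𝔾(𝔸_F^∞)`-action is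
  the ⟨CARRIER⟩ `D.omega ε χ` / `D.rho ε χ : Representation ℂ D.G (D.omega ε χ)`.  Def. 4.11 defines `ω(μ, ε, χ)` for
  EVERY triple, so the record quantifies over all `(ε, χ)`, not only over the `μ`-admissible `ε` of Thm. 4.18's index set
  (corollaries restrict to `D.AdmIndex`).
* «`:= ⊗'_v ω(μ_v, ε_v, χ_v)`» and «unramified for all but finitely many `v`» are the CONSTRUCTION of the object the
  carrier `D.omega` stands for — part of its MEANING (the datum carries no local groups `𝔾(F_v)` or local factors, so no
  restricted-tensor-product structure can be imposed on it here; the tree's typed notion, for consumers who DO carry local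
  data, is `IsRestrictedTensorProductRep`, `Literature/NumberTheory/Automorphic/AutomorphicGLnFlathProofs.lean`).  What
  the sentence PREDICATES of `ω(μ, ε, χ)` as a representation of `𝔾(𝔸_F^∞)` — «irreducible admissible» — is what is typed.
* READING I1 («irreducible»).  In this paper the word is applied to a possibly-ZERO representation: Lemma D.1 states
  «`ω(μ, ε, χ)` is irreducible and admissible. Moreover, (1) `ω(μ, ε, χ)` is zero if and only if …» (l. 5226–5229), and for
  `n = 2` some adèlic `ω(μ, ε, χ)` of Def. 4.11 ARE zero (a zero local factor at an anisotropic place).  So «irreducible»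
  is typed as «no subrepresentation other than `0` and the whole space» — `IsIrreducibleOrZero`: every
  `Subrepresentation` is `⊥` or `⊤` — which for a NON-ZERO space is exactly Mathlib's `Representation.IsIrreducible`
  (`IsSimpleOrder (Subrepresentation ρ)`; corollary `isIrreducible_of_nontrivial`).  The record therefore carries NO
  non-vanishing: that `ω(μ, ε, χ) ≠ 0` (for `n ≥ 3`: every local factor is non-zero by Lemma D.1 (1), hence so is the
  restricted tensor product) is a SEPARATE printed input (App. D), not part of Def. 4.11's sentence, and stays the
  consumer's (the junction's `hirr` in Mathlib's sense = this record + non-vanishing).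
* READING I2 («admissible representation of `𝔾(𝔸_F^∞)`»).  For the totally disconnected locally compact group
  `𝔾(𝔸_F^∞)` acting on a complex vector space with no topology, the standard meaning [BernsteinZelevinsky1976, §2.1;
  Bump1997, §3.1 / §4.2]: SMOOTH — every vector is fixed by an open subgroup — and ADMISSIBLE — for every open compact
  subgroup `K` the space of `K`-fixed vectors is finite-dimensional.  Typed as `IsSmoothRep ρ ∧ IsAdmissibleRep ρ` on
  `D.G`'s topology (`IsOpenCompact` of `Thm418AsPrinted`).  `IsSmoothRep` is, token for token, the junction's binder `hsm`.

No hypothesis is added and none dropped; I1–I2 are the only interpretive choices.  NO PROOF (Track 2).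

## References

* [Liu2021] Y. Liu, *Fourier–Jacobi cycles and arithmetic relative trace formula*, Camb. J. Math. 9 (2021) 1–147,
  arXiv:2102.11518 — Def. 4.11 (l. 2083–2097); App. D Lemma D.1 (l. 5226–5238).
* [BernsteinZelevinsky1976] I. N. Bernstein, A. V. Zelevinsky, *Representations of the group GL(n, F) where F is a
  non-archimedean local field*, Russian Math. Surveys 31 (1976) — §2.1 (smooth, admissible).
* [Bump1997] D. Bump, *Automorphic Forms and Representations*, CUP 1997 — §3.1.
-/

noncomputable section

open NumberField

namespace Literature.NumberTheory.Automorphic.Liu2021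

/-! ## The two printed adjectives, for a representation of a topological group on a `ℂ`-vector space -/

section Adjectives

variable {G V : Type} [Group G] [AddCommGroup V] [Module ℂ V] (ρ : Representation ℂ G V)

/-- READING I1 of «irreducible» as [Liu2021] uses the word (Def. 4.11 l. 2096 together with Lemma D.1 l. 5226–5229, where
an «irreducible and admissible» representation may be «zero»): `ρ` has no subrepresentation other than `0` and the whole
space.  For a non-zero space this is Mathlib's `Representation.IsIrreducible` (`isIrreducible_of_nontrivial`).
[cite: Liu2021, Def. 4.11 and Lemma D.1] -/
def IsIrreducibleOrZero : Prop :=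
  ∀ W : Subrepresentation ρ, W = ⊥ ∨ W = ⊤

/-- The `K`-fixed vectors of a subgroup `K ≤ G` in `ρ`, as a `ℂ`-subspace (Mathlib's `Representation.invariants` of the
restriction of `ρ` to `K`). [cite: Liu2021, Def. 4.11] -/
def fixedSubmodule (K : Subgroup G) : Submodule ℂ V :=
  Representation.invariants (MonoidHom.comp ρ K.subtype : Representation ℂ K V)

variable {ρ}

/-- Unfolding of `fixedSubmodule`. [cite: Liu2021, Def. 4.11] -/
theorem mem_fixedSubmodule_iff (K : Subgroup G) (v : V) : v ∈ fixedSubmodule ρ K ↔ ∀ k ∈ K, ρ k v = v := by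
  unfold fixedSubmodule
  rw [Representation.mem_invariants]
  constructor
  · intro h k hk
    exact h ⟨k, hk⟩
  · intro h k
    exact h k k.2

/-- READING I1 against Mathlib: on a non-zero space, «irreducible in Liu's sense» is `Representation.IsIrreducible`.
[cite: Liu2021, Def. 4.11 and Lemma D.1] -/
theorem isIrreducible_of_nontrivial [Nontrivial V] (h : IsIrreducibleOrZero ρ) : ρ.IsIrreducible := by
  haveI : Nontrivial (Subrepresentation ρ) := by
    refine ⟨⟨⊥, ⊤, fun hbt => ?_⟩⟩
    have h' : ((⊥ : Subrepresentation ρ) : Set V) = ((⊤ : Subrepresentation ρ) : Set V) := by rw [hbt]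
    obtain ⟨x, hx⟩ := exists_ne (0 : V)
    have hxtop : x ∈ ((⊤ : Subrepresentation ρ) : Set V) := (Submodule.mem_top : x ∈ (⊤ : Submodule ℂ V))
    rw [← h'] at hxtop
    exact hx ((Submodule.mem_bot ℂ).1 hxtop)
  exact ⟨h⟩

/-- Conversely Mathlib-irreducible representations are irreducible in Liu's sense. [cite: Liu2021, Def. 4.11] -/
theorem isIrreducibleOrZero_of_isIrreducible (h : ρ.IsIrreducible) : IsIrreducibleOrZero ρ :=
  fun W => h.eq_bot_or_eq_top W

variable (ρ) [TopologicalSpace G]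

/-- READING I2, first half: `ρ` is SMOOTH — every vector is fixed by some open subgroup of `G`
([BernsteinZelevinsky1976, §2.1]; the meaning of «admissible representation of `𝔾(𝔸_F^∞)`» in [Liu2021] Def. 4.11
includes smoothness).  Token for token the stage-2 junction's binder `hsm`. [cite: Liu2021, Def. 4.11] -/
def IsSmoothRep : Prop :=
  ∀ v : V, ∃ S : Subgroup G, IsOpen (S : Set G) ∧ ∀ k ∈ S, ρ k v = v

/-- READING I2, second half: `ρ` is ADMISSIBLE — for every open compact subgroup `K ≤ G` the space of `K`-fixed vectors
is finite-dimensional ([BernsteinZelevinsky1976, §2.1]; `IsOpenCompact` as in `Thm418AsPrinted`). [cite: Liu2021, Def. 4.11] -/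
def IsAdmissibleRep : Prop :=
  ∀ K : Subgroup G, IsOpenCompact K → FiniteDimensional ℂ (fixedSubmodule ρ K)

end Adjectives

/-! ## Definition 4.11, exactly as printed, over the datum of Theorem 4.18 -/

/-- **[Liu2021, Definition 4.11] EXACTLY AS PRINTED** (`FJcycle.tex` l. 2083–2097 = `paper:arxiv-2102.11518` p0020
L29–42), for the datum `D` of `Thm418AsPrinted` (standing hypotheses l. 1878: `F` totally real, `E/F` totally imaginary
quadratic — the instance arguments; `μ = D.μ` conjugate symplectic; carriers `D.Eps`, `D.Chi`, `D.omega`/`D.rho`, `D.G`):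

«For an adèlic oscillator triple `(μ, ε, χ)`, the local oscillator representation `ω(μ_v, ε_v, χ_v)` of `𝔾(F_v)`
introduced in Subsection D.1 is unramified for all but finitely many `v`. Thus, it makes sense to define the *adèlic
oscillator representation* attached to `(μ, ε, χ)`, `ω(μ, ε, χ) := ⊗'_v ω(μ_v, ε_v, χ_v)`, which is an irreducible
admissible representation of `𝔾(𝔸_F^∞)`.»

TYPED as: for every `ε` and every `χ` (every adèlic oscillator triple with first entry `μ`), the representation
`D.rho ε χ` of `D.G = 𝔾(𝔸_F^∞)` on `D.omega ε χ = ω(μ, ε, χ)` is irreducible (READING I1: every subrepresentation is `0`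
or everything — the paper's convention, which allows `0`), smooth and admissible (READING I2).  The restricted tensor
product `⊗'_v` is the construction of the carrier, not a typed clause (module docstring).  A consumer takes
`(h : Def411AsPrinted D)` for ITS OWN `D`; `∀ D, Def411AsPrinted D` is not claimed.  NO PROOF (Track 2).
[cite: Liu2021, Def. 4.11] -/
def Def411AsPrinted {F E : Type} [Field F] [NumberField F] [IsTotallyReal F] [Field E] [NumberField E] [Algebra F E]
    [IsTotallyComplex E] [Algebra.IsQuadraticExtension F E] (D : Thm418Data F E) : Prop :=
  ∀ (ε : D.Eps) (χ : D.Chi),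
    IsIrreducibleOrZero (D.rho ε χ) ∧ IsSmoothRep (D.rho ε χ) ∧ IsAdmissibleRep (D.rho ε χ)

namespace Thm418Data

variable {F E : Type} [Field F] [NumberField F] [IsTotallyReal F] [Field E] [NumberField E] [Algebra F E]
  [IsTotallyComplex E] [Algebra.IsQuadraticExtension F E] {D : Thm418Data F E}

/-- Dot-notation alias: `D.Def411AsPrinted`. [cite: Liu2021, Def. 4.11] -/
protected abbrev Def411AsPrinted (D : Thm418Data F E) : Prop := Liu2021.Def411AsPrinted D

/-- At an index `i = (ε, χ)` of Thm. 4.18's direct sum, `ω_i` is irreducible in the paper's sense.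
[cite: Liu2021, Def. 4.11] -/
theorem isIrreducibleOrZero_rhoAt (h : Liu2021.Def411AsPrinted D) (i : D.AdmIndex) :
    IsIrreducibleOrZero (D.rhoAt i) :=
  (h i.1.1 i.1.2).1

/-- At an index `i` with `ω_i ≠ 0`, `ω_i` is irreducible in Mathlib's sense — the shape of the stage-2 junction's binder
`hirr` (`Item6SupplyPinned.lean` :177), which is thus Def. 4.11 AS PRINTED plus non-vanishing. [cite: Liu2021, Def. 4.11] -/
theorem isIrreducible_rhoAt (h : Liu2021.Def411AsPrinted D) (i : D.AdmIndex) [Nontrivial (D.omegaAt i)] :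
    (D.rhoAt i).IsIrreducible :=
  isIrreducible_of_nontrivial (h i.1.1 i.1.2).1

/-- Smoothness at an index `i`, in EXACTLY the shape of the stage-2 junction's binder `hsm` (`Item6SupplyPinned.lean`
:179): every vector of `ω_i` is fixed by an open subgroup of `𝔾(𝔸_F^∞)`. [cite: Liu2021, Def. 4.11] -/
theorem exists_isOpen_forall_rhoAt_eq (h : Liu2021.Def411AsPrinted D) (i : D.AdmIndex) (v : D.omegaAt i) :
    ∃ S : Subgroup D.G, IsOpen (S : Set D.G) ∧ ∀ k ∈ S, D.rhoAt i k v = v :=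
  (h i.1.1 i.1.2).2.1 v

/-- Admissibility at an index `i`: finite-dimensional `K`-fixed vectors for every open compact `K`.
[cite: Liu2021, Def. 4.11] -/
theorem finiteDimensional_fixedSubmodule_rhoAt (h : Liu2021.Def411AsPrinted D) (i : D.AdmIndex) (K : Subgroup D.G)
    (hK : IsOpenCompact K) : FiniteDimensional ℂ (fixedSubmodule (D.rhoAt i) K) :=
  (h i.1.1 i.1.2).2.2 K hK

end Thm418Data

end Literature.NumberTheory.Automorphic.Liu2021

end
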